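import Mathlib

/-!
# STEP is closed under parallel composition with strands of edge-connectivity ≤ 3
(seat mine-b, cell pub-perc-repro2; conjectures/MINE-B.md §10.3, proofs/MINE-B-DUAL.md §11)

Continuation of `StepClosure.lean`: the two-copy STEP inequality `H(i,j) ≤ H(i+1,j−1)` (`i+2 ≤ j`,
`H(i,j) = #{F_R = i, F_B ≥ j}`) is preserved when a strand whose joint law lives on `{0,1,2,3}²`
(edge-connectivity `≤ 3`, any pattern) is added in parallel, PROVIDED the strand satisfies STEP
itself: `w02 + w03 ≤ w11 + w12 + w13`, `w03 ≤ w12 + w13`, `w13 ≤ w22 + w23`.  These are not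
consequences of Reimer's inequality (which gives only `w02 + w03 ≤ w11 + w12 + w13 + w23`), so this
is a conditional reduction: pattern-level STEP (hence BAL) for parallel compositions of strands of
edge-connectivity `≤ 3` follows from STEP on each strand.  The threshold is sharp (strands on
`{0..4}²` can break STEP: MINE-B.md NEG-B11).  Proof: the bad increments `w02 σ(i,i)`,
`w13 σ(i−1,i−1)`, `w03 σ(i,i−1)` (`j = i+2`) and `w03 σ(i,i)` (`j = i+3`) are rewritten by the swap
identities `I1: σ(x,x+1) = σ(x,x+2)`, `I2: σ(x,x) = σ(x−1,x+2) + σ(x,x+2) − σ(x−1,x+1)`, `I3: σ(x,x−1)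
= σ(x−2,x+2) + σ(x−1,x+2) + σ(x,x+2) − σ(x−2,x+1) − σ(x−1,x+1)`; the three strand inequalities are
exactly the coefficients of the remaining negative terms. -/

namespace Summit.Ventures.PercRepro2.Step3

/-- the mixed pmf/tail `H(i,j)` after `m` strands with symmetric weights on `{0,1,2,3}²` -/
noncomputable def stepH (w00 w01 w02 w03 w11 w12 w13 w22 w23 w33 : ℕ → ℝ) : ℕ → ℤ → ℤ → ℝ
  | 0, i, j => if i = 0 ∧ j ≤ 0 then 1 else 0
  | m + 1, i, j =>
      let S := stepH w00 w01 w02 w03 w11 w12 w13 w22 w23 w33 m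
      w00 m * S i j + w01 m * (S (i - 1) j + S i (j - 1)) + w02 m * (S (i - 2) j + S i (j - 2))
      + w03 m * (S (i - 3) j + S i (j - 3)) + w11 m * S (i - 1) (j - 1)
      + w12 m * (S (i - 2) (j - 1) + S (i - 1) (j - 2)) + w13 m * (S (i - 3) (j - 1) + S (i - 1) (j - 3))
      + w22 m * S (i - 2) (j - 2) + w23 m * (S (i - 3) (j - 2) + S (i - 2) (j - 3))
      + w33 m * S (i - 3) (j - 3)

variable (w00 w01 w02 w03 w11 w12 w13 w22 w23 w33 : ℕ → ℝ)

/-- nonnegativity -/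
theorem stepH_nonneg (h00 : ∀ k, 0 ≤ w00 k) (h01 : ∀ k, 0 ≤ w01 k) (h02 : ∀ k, 0 ≤ w02 k)
    (h03 : ∀ k, 0 ≤ w03 k) (h11 : ∀ k, 0 ≤ w11 k) (h12 : ∀ k, 0 ≤ w12 k) (h13 : ∀ k, 0 ≤ w13 k)
    (h22 : ∀ k, 0 ≤ w22 k) (h23 : ∀ k, 0 ≤ w23 k) (h33 : ∀ k, 0 ≤ w33 k) :
    ∀ (m : ℕ) (i j : ℤ), 0 ≤ stepH w00 w01 w02 w03 w11 w12 w13 w22 w23 w33 m i j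
  | 0, i, j => by
      simp only [stepH]; split_ifs <;> norm_num
  | m + 1, i, j => by
      simp only [stepH]
      have n := stepH_nonneg h00 h01 h02 h03 h11 h12 h13 h22 h23 h33 m
      have a1 := mul_nonneg (h00 m) (n i j)
      have a2 := mul_nonneg (h01 m) (add_nonneg (n (i - 1) j) (n i (j - 1)))
      have a3 := mul_nonneg (h02 m) (add_nonneg (n (i - 2) j) (n i (j - 2)))
      have a4 := mul_nonneg (h03 m) (add_nonneg (n (i - 3) j) (n i (j - 3)))
      have a5 := mul_nonneg (h11 m) (n (i - 1) (j - 1))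
      have a6 := mul_nonneg (h12 m) (add_nonneg (n (i - 2) (j - 1)) (n (i - 1) (j - 2)))
      have a7 := mul_nonneg (h13 m) (add_nonneg (n (i - 3) (j - 1)) (n (i - 1) (j - 3)))
      have a8 := mul_nonneg (h22 m) (n (i - 2) (j - 2))
      have a9 := mul_nonneg (h23 m) (add_nonneg (n (i - 3) (j - 2)) (n (i - 2) (j - 3)))
      have a10 := mul_nonneg (h33 m) (n (i - 3) (j - 3))
      linarith

/-- colour-swap symmetry of the joint pmf `N(x,y) = H(x,y) − H(x,y+1)` -/
theorem stepH_swap : ∀ (m : ℕ) (x y : ℤ),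
    stepH w00 w01 w02 w03 w11 w12 w13 w22 w23 w33 m x y
        - stepH w00 w01 w02 w03 w11 w12 w13 w22 w23 w33 m x (y + 1)
      = stepH w00 w01 w02 w03 w11 w12 w13 w22 w23 w33 m y x
        - stepH w00 w01 w02 w03 w11 w12 w13 w22 w23 w33 m y (x + 1)
  | 0, x, y => by
      simp only [stepH]
      split_ifs <;> first | (norm_num; done) | (exfalso; omega)
  | m + 1, x, y => by
      simp only [stepH]
      have e00 := stepH_swap m x y
      have e10 := stepH_swap m (x - 1) y
      have e01 := stepH_swap m x (y - 1)
      have e20 := stepH_swap m (x - 2) y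
      have e02 := stepH_swap m x (y - 2)
      have e30 := stepH_swap m (x - 3) y
      have e03 := stepH_swap m x (y - 3)
      have e11 := stepH_swap m (x - 1) (y - 1)
      have e21 := stepH_swap m (x - 2) (y - 1)
      have e12 := stepH_swap m (x - 1) (y - 2)
      have e31 := stepH_swap m (x - 3) (y - 1)
      have e13 := stepH_swap m (x - 1) (y - 3)
      have e22 := stepH_swap m (x - 2) (y - 2)
      have e32 := stepH_swap m (x - 3) (y - 2)
      have e23 := stepH_swap m (x - 2) (y - 3)
      have e33 := stepH_swap m (x - 3) (y - 3)
      simp only [show ∀ z : ℤ, z + 1 - 1 = z from fun z => by ring,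
        show ∀ z : ℤ, z - 1 + 1 = z from fun z => by ring,
        show ∀ z : ℤ, z + 1 - 2 = z - 1 from fun z => by ring,
        show ∀ z : ℤ, z - 2 + 1 = z - 1 from fun z => by ring,
        show ∀ z : ℤ, z + 1 - 3 = z - 2 from fun z => by ring,
        show ∀ z : ℤ, z - 3 + 1 = z - 2 from fun z => by ring]
        at e00 e10 e01 e20 e02 e30 e03 e11 e21 e12 e31 e13 e22 e32 e23 e33 ⊢
      linear_combination
        w00 m * e00 + w01 m * e10 + w01 m * e01 + w02 m * e20 + w02 m * e02 + w03 m * e30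
          + w03 m * e03 + w11 m * e11 + w12 m * e21 + w12 m * e12 + w13 m * e31 + w13 m * e13
          + w22 m * e22 + w23 m * e32 + w23 m * e23 + w33 m * e33

/-- one strand on `{0,1,2,3}²` (abstract form): STEP of `S`, its swap symmetry and the three STEP
inequalities of the strand give STEP of the composition at `(i, j)`, `i + 2 ≤ j` -/
theorem step_aux (S : ℤ → ℤ → ℝ) (a00 a01 a02 a03 a11 a12 a13 a22 a23 a33 : ℝ)
    (h00 : 0 ≤ a00) (h01 : 0 ≤ a01) (h02 : 0 ≤ a02) (h03 : 0 ≤ a03) (h11 : 0 ≤ a11)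
    (h12 : 0 ≤ a12) (h13 : 0 ≤ a13) (h22 : 0 ≤ a22) (h23 : 0 ≤ a23) (h33 : 0 ≤ a33)
    (hB1 : a02 + a03 ≤ a11 + a12 + a13) (hB2 : a03 ≤ a12 + a13) (hB3 : a13 ≤ a22 + a23)
    (IH : ∀ a b : ℤ, a + 2 ≤ b → S a b ≤ S (a + 1) (b - 1))
    (sw : ∀ x y : ℤ, S x y - S x (y + 1) = S y x - S y (x + 1))
    (i j : ℤ) (hij : i + 2 ≤ j) :
    a00 * S i j + a01 * (S (i - 1) j + S i (j - 1)) + a02 * (S (i - 2) j + S i (j - 2))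
      + a03 * (S (i - 3) j + S i (j - 3)) + a11 * S (i - 1) (j - 1)
      + a12 * (S (i - 2) (j - 1) + S (i - 1) (j - 2)) + a13 * (S (i - 3) (j - 1) + S (i - 1) (j - 3))
      + a22 * S (i - 2) (j - 2) + a23 * (S (i - 3) (j - 2) + S (i - 2) (j - 3))
      + a33 * S (i - 3) (j - 3)
    ≤ a00 * S (i + 1) (j - 1) + a01 * (S i (j - 1) + S (i + 1) (j - 2))
      + a02 * (S (i - 1) (j - 1) + S (i + 1) (j - 3)) + a03 * (S (i - 2) (j - 1) + S (i + 1) (j - 4))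
      + a11 * S i (j - 2) + a12 * (S (i - 1) (j - 2) + S i (j - 3))
      + a13 * (S (i - 2) (j - 2) + S i (j - 4)) + a22 * S (i - 1) (j - 3)
      + a23 * (S (i - 2) (j - 3) + S (i - 1) (j - 4)) + a33 * S (i - 2) (j - 4) := by
  -- normalisation helpers and the identities from the swap symmetry
  have nz : ∀ z : ℤ, z - 1 + 1 = z := fun z => by ring
  have n2 : ∀ z : ℤ, z - 2 + 1 = z - 1 := fun z => by ring
  have n3 : ∀ z : ℤ, z - 3 + 1 = z - 2 := fun z => by ring
  have m1 : ∀ z : ℤ, z - 1 - 1 = z - 2 := fun z => by ring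
  have m2 : ∀ z : ℤ, z - 2 - 1 = z - 3 := fun z => by ring
  have m3 : ∀ z : ℤ, z - 3 - 1 = z - 4 := fun z => by ring
  have I1 : ∀ x : ℤ, S (x + 1) x - S (x + 1) (x + 1) = S x (x + 1) - S x (x + 2) := fun x => by
    have := sw (x + 1) x; rwa [show (x + 1 + 1 : ℤ) = x + 2 by ring] at this
  have I2 : ∀ x : ℤ, S (x + 1) (x - 1) - S x x
      = (S x (x + 1) - S (x - 1) (x + 2)) + (S (x + 1) (x + 1) - S x (x + 2))
        - (S x x - S (x - 1) (x + 1)) := fun x => by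
    have h1 := sw (x + 1) (x - 1); have h2 := sw (x + 1) x
    rw [nz, show (x + 1 + 1 : ℤ) = x + 2 by ring] at h1
    rw [show (x + 1 + 1 : ℤ) = x + 2 by ring] at h2
    linear_combination h1 + h2
  have I3 : ∀ x : ℤ, S (x + 1) (x - 2) - S x (x - 1)
      = (S (x - 1) (x + 1) - S (x - 2) (x + 2)) + (S x (x + 1) - S (x - 1) (x + 2))
        + (S (x + 1) (x + 1) - S x (x + 2)) - (S (x - 1) x - S (x - 2) (x + 1))
        - (S x x - S (x - 1) (x + 1)) := fun x => by
    have h1 := sw (x - 2) (x + 1); have h2 := sw (x - 1) x; have h3 := sw (x - 1) (x + 1)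
    have h4 := sw x (x + 1)
    rw [show (x + 1 + 1 : ℤ) = x + 2 by ring, show (x - 2 + 1 : ℤ) = x - 1 by ring] at h1
    rw [show (x - 1 + 1 : ℤ) = x by ring] at h2
    rw [show (x + 1 + 1 : ℤ) = x + 2 by ring, show (x - 1 + 1 : ℤ) = x by ring] at h3
    rw [show (x + 1 + 1 : ℤ) = x + 2 by ring] at h4
    linear_combination (-1 : ℝ) * h1 + h2 - h3 - h4
  obtain h | h | h | h : j = i + 2 ∨ j = i + 3 ∨ j = i + 4 ∨ i + 5 ≤ j := by omega
  · -- j = i + 2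
    subst h
    simp only [show (i + 2 - 1 : ℤ) = i + 1 by ring, show (i + 2 - 2 : ℤ) = i by ring,
      show (i + 2 - 3 : ℤ) = i - 1 by ring, show (i + 2 - 4 : ℤ) = i - 2 by ring]
    have t00 : S i (i + 2) ≤ S (i + 1) (i + 1) := by
      have := IH i (i + 2) (by omega); rwa [show (i + 2 - 1 : ℤ) = i + 1 by ring] at this
    have t10 : S (i - 1) (i + 2) ≤ S i (i + 1) := by
      have := IH (i - 1) (i + 2) (by omega); rwa [nz, show (i + 2 - 1 : ℤ) = i + 1 by ring] at this
    have t20 : S (i - 2) (i + 2) ≤ S (i - 1) (i + 1) := by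
      have := IH (i - 2) (i + 2) (by omega)
      rwa [show (i - 2 + 1 : ℤ) = i - 1 by ring, show (i + 2 - 1 : ℤ) = i + 1 by ring] at this
    have t30 : S (i - 3) (i + 2) ≤ S (i - 2) (i + 1) := by
      have := IH (i - 3) (i + 2) (by omega)
      rwa [show (i - 3 + 1 : ℤ) = i - 2 by ring, show (i + 2 - 1 : ℤ) = i + 1 by ring] at this
    have t11 : S (i - 1) (i + 1) ≤ S i i := by
      have := IH (i - 1) (i + 1) (by omega); rwa [nz, show (i + 1 - 1 : ℤ) = i by ring] at this
    have t21 : S (i - 2) (i + 1) ≤ S (i - 1) i := by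
      have := IH (i - 2) (i + 1) (by omega)
      rwa [show (i - 2 + 1 : ℤ) = i - 1 by ring, show (i + 1 - 1 : ℤ) = i by ring] at this
    have t31 : S (i - 3) (i + 1) ≤ S (i - 2) i := by
      have := IH (i - 3) (i + 1) (by omega)
      rwa [show (i - 3 + 1 : ℤ) = i - 2 by ring, show (i + 1 - 1 : ℤ) = i by ring] at this
    have t22 : S (i - 2) i ≤ S (i - 1) (i - 1) := by
      have := IH (i - 2) i (by omega); rwa [show (i - 2 + 1 : ℤ) = i - 1 by ring] at this
    have t32 : S (i - 3) i ≤ S (i - 2) (i - 1) := by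
      have := IH (i - 3) i (by omega); rwa [show (i - 3 + 1 : ℤ) = i - 2 by ring] at this
    have t33 : S (i - 3) (i - 1) ≤ S (i - 2) (i - 2) := by
      have := IH (i - 3) (i - 1) (by omega)
      rwa [show (i - 3 + 1 : ℤ) = i - 2 by ring, show (i - 1 - 1 : ℤ) = i - 2 by ring] at this
    have J1 := I1 i
    have J1' := I1 (i - 1); rw [nz, show (i - 1 + 2 : ℤ) = i + 1 by ring] at J1'
    have J1'' := I1 (i - 2)
    rw [show (i - 2 + 1 : ℤ) = i - 1 by ring, show (i - 2 + 2 : ℤ) = i by ring] at J1''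
    have J2 := I2 i
    have J2' := I2 (i - 1)
    rw [nz, show (i - 1 - 1 : ℤ) = i - 2 by ring, show (i - 1 + 2 : ℤ) = i + 1 by ring] at J2'
    have J3 := I3 i
    have t01 : S i (i + 1) ≤ S (i + 1) i := by linarith
    have t12 : S (i - 1) i ≤ S i (i - 1) := by linarith
    have t23 : S (i - 2) (i - 1) ≤ S (i - 1) (i - 2) := by linarith
    have P00 := mul_le_mul_of_nonneg_left t00 h00
    have P10 := mul_le_mul_of_nonneg_left t10 h01
    have P01 := mul_le_mul_of_nonneg_left t01 h01
    have P20 := mul_le_mul_of_nonneg_left t20 h02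
    have P30 := mul_le_mul_of_nonneg_left t30 h03
    have P11 := mul_le_mul_of_nonneg_left t11 h11
    have P21 := mul_le_mul_of_nonneg_left t21 h12
    have P12 := mul_le_mul_of_nonneg_left t12 h12
    have P31 := mul_le_mul_of_nonneg_left t31 h13
    have P22 := mul_le_mul_of_nonneg_left t22 h22
    have P32 := mul_le_mul_of_nonneg_left t32 h23
    have P23 := mul_le_mul_of_nonneg_left t23 h23
    have P33 := mul_le_mul_of_nonneg_left t33 h33
    have E02 := congrArg (fun t => a02 * t) J2
    have E13 := congrArg (fun t => a13 * t) J2'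
    have E03 := congrArg (fun t => a03 * t) J3
    have E01 := congrArg (fun t => a01 * t) J1
    have E12 := congrArg (fun t => a12 * t) J1'
    have E23 := congrArg (fun t => a23 * t) J1''
    simp only [mul_sub, mul_add] at E02 E13 E03 E01 E12 E23
    have PA : 0 ≤ (a11 + a12 + a13 - a02 - a03) * (S i i - S (i - 1) (i + 1)) :=
      mul_nonneg (by linarith) (by linarith)
    have PB : 0 ≤ (a12 + a13 - a03) * (S (i - 1) i - S (i - 2) (i + 1)) :=
      mul_nonneg (by linarith) (by linarith)
    have PC : 0 ≤ (a22 + a23 - a13) * (S (i - 1) (i - 1) - S (i - 2) i) :=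
      mul_nonneg (by linarith) (by linarith)
    simp only [sub_mul, add_mul, mul_sub] at PA PB PC
    -- the good increments that enter with the weights a02, a03, a13 through the identities
    have Q1 := mul_le_mul_of_nonneg_left t10 h02
    have Q2 := mul_le_mul_of_nonneg_left t00 h02
    have Q3 := mul_le_mul_of_nonneg_left t20 h03
    have Q4 := mul_le_mul_of_nonneg_left t10 h03
    have Q5 := mul_le_mul_of_nonneg_left t00 h03
    have Q6 := mul_le_mul_of_nonneg_left t21 h13
    linarith
  · -- j = i + 3: the only bad increment is `a03 σ(i,i)`
    subst h
    simp only [show (i + 3 - 1 : ℤ) = i + 2 by ring, show (i + 3 - 2 : ℤ) = i + 1 by ring,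
      show (i + 3 - 3 : ℤ) = i by ring, show (i + 3 - 4 : ℤ) = i - 1 by ring]
    have t00 : S i (i + 3) ≤ S (i + 1) (i + 2) := by
      have := IH i (i + 3) (by omega); rwa [show (i + 3 - 1 : ℤ) = i + 2 by ring] at this
    have t10 : S (i - 1) (i + 3) ≤ S i (i + 2) := by
      have := IH (i - 1) (i + 3) (by omega); rwa [nz, show (i + 3 - 1 : ℤ) = i + 2 by ring] at this
    have t01 : S i (i + 2) ≤ S (i + 1) (i + 1) := by
      have := IH i (i + 2) (by omega); rwa [show (i + 2 - 1 : ℤ) = i + 1 by ring] at this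
    have t20 : S (i - 2) (i + 3) ≤ S (i - 1) (i + 2) := by
      have := IH (i - 2) (i + 3) (by omega); rwa [n2, show (i + 3 - 1 : ℤ) = i + 2 by ring] at this
    have t30 : S (i - 3) (i + 3) ≤ S (i - 2) (i + 2) := by
      have := IH (i - 3) (i + 3) (by omega); rwa [n3, show (i + 3 - 1 : ℤ) = i + 2 by ring] at this
    have t11 : S (i - 1) (i + 2) ≤ S i (i + 1) := by
      have := IH (i - 1) (i + 2) (by omega); rwa [nz, show (i + 2 - 1 : ℤ) = i + 1 by ring] at this
    have t21 : S (i - 2) (i + 2) ≤ S (i - 1) (i + 1) := by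
      have := IH (i - 2) (i + 2) (by omega); rwa [n2, show (i + 2 - 1 : ℤ) = i + 1 by ring] at this
    have t12 : S (i - 1) (i + 1) ≤ S i i := by
      have := IH (i - 1) (i + 1) (by omega); rwa [nz, show (i + 1 - 1 : ℤ) = i by ring] at this
    have t31 : S (i - 3) (i + 2) ≤ S (i - 2) (i + 1) := by
      have := IH (i - 3) (i + 2) (by omega); rwa [n3, show (i + 2 - 1 : ℤ) = i + 1 by ring] at this
    have t22 : S (i - 2) (i + 1) ≤ S (i - 1) i := by
      have := IH (i - 2) (i + 1) (by omega); rwa [n2, show (i + 1 - 1 : ℤ) = i by ring] at this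
    have t32 : S (i - 3) (i + 1) ≤ S (i - 2) i := by
      have := IH (i - 3) (i + 1) (by omega); rwa [n3, show (i + 1 - 1 : ℤ) = i by ring] at this
    have t23 : S (i - 2) i ≤ S (i - 1) (i - 1) := by
      have := IH (i - 2) i (by omega); rwa [n2] at this
    have t33 : S (i - 3) i ≤ S (i - 2) (i - 1) := by
      have := IH (i - 3) i (by omega); rwa [n3] at this
    have J1 := I1 i
    have J1' := I1 (i - 1); rw [nz, show (i - 1 + 2 : ℤ) = i + 1 by ring] at J1'
    have J2 := I2 i
    have t02 : S i (i + 1) ≤ S (i + 1) i := by linarith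
    have t13 : S (i - 1) i ≤ S i (i - 1) := by linarith
    have P00 := mul_le_mul_of_nonneg_left t00 h00
    have P10 := mul_le_mul_of_nonneg_left t10 h01
    have P01 := mul_le_mul_of_nonneg_left t01 h01
    have P20 := mul_le_mul_of_nonneg_left t20 h02
    have P02 := mul_le_mul_of_nonneg_left t02 h02
    have P30 := mul_le_mul_of_nonneg_left t30 h03
    have P11 := mul_le_mul_of_nonneg_left t11 h11
    have P21 := mul_le_mul_of_nonneg_left t21 h12
    have P31 := mul_le_mul_of_nonneg_left t31 h13
    have P22 := mul_le_mul_of_nonneg_left t22 h22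
    have P32 := mul_le_mul_of_nonneg_left t32 h23
    have P23 := mul_le_mul_of_nonneg_left t23 h23
    have P33 := mul_le_mul_of_nonneg_left t33 h33
    have Q1 := mul_le_mul_of_nonneg_left t11 h03
    have Q2 := mul_le_mul_of_nonneg_left t01 h03
    have E03 := congrArg (fun t => a03 * t) J2
    have E13 := congrArg (fun t => a13 * t) J1'
    simp only [mul_sub, mul_add] at E03 E13
    have PA : 0 ≤ (a12 + a13 - a03) * (S i i - S (i - 1) (i + 1)) :=
      mul_nonneg (by linarith) (by linarith)
    simp only [sub_mul, add_mul, mul_sub] at PA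
    linarith
  · -- j = i + 4: every term is direct except `(0,3)`, which is `I1`
    subst h
    simp only [show (i + 4 - 1 : ℤ) = i + 3 by ring, show (i + 4 - 2 : ℤ) = i + 2 by ring,
      show (i + 4 - 3 : ℤ) = i + 1 by ring, show (i + 4 - 4 : ℤ) = i by ring]
    have t00 : S i (i + 4) ≤ S (i + 1) (i + 3) := by
      have := IH i (i + 4) (by omega); rwa [show (i + 4 - 1 : ℤ) = i + 3 by ring] at this
    have t10 : S (i - 1) (i + 4) ≤ S i (i + 3) := by
      have := IH (i - 1) (i + 4) (by omega); rwa [nz, show (i + 4 - 1 : ℤ) = i + 3 by ring] at this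
    have t01 : S i (i + 3) ≤ S (i + 1) (i + 2) := by
      have := IH i (i + 3) (by omega); rwa [show (i + 3 - 1 : ℤ) = i + 2 by ring] at this
    have t20 : S (i - 2) (i + 4) ≤ S (i - 1) (i + 3) := by
      have := IH (i - 2) (i + 4) (by omega); rwa [n2, show (i + 4 - 1 : ℤ) = i + 3 by ring] at this
    have t02 : S i (i + 2) ≤ S (i + 1) (i + 1) := by
      have := IH i (i + 2) (by omega); rwa [show (i + 2 - 1 : ℤ) = i + 1 by ring] at this
    have t30 : S (i - 3) (i + 4) ≤ S (i - 2) (i + 3) := by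
      have := IH (i - 3) (i + 4) (by omega); rwa [n3, show (i + 4 - 1 : ℤ) = i + 3 by ring] at this
    have t11 : S (i - 1) (i + 3) ≤ S i (i + 2) := by
      have := IH (i - 1) (i + 3) (by omega); rwa [nz, show (i + 3 - 1 : ℤ) = i + 2 by ring] at this
    have t21 : S (i - 2) (i + 3) ≤ S (i - 1) (i + 2) := by
      have := IH (i - 2) (i + 3) (by omega); rwa [n2, show (i + 3 - 1 : ℤ) = i + 2 by ring] at this
    have t12 : S (i - 1) (i + 2) ≤ S i (i + 1) := by
      have := IH (i - 1) (i + 2) (by omega); rwa [nz, show (i + 2 - 1 : ℤ) = i + 1 by ring] at this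
    have t31 : S (i - 3) (i + 3) ≤ S (i - 2) (i + 2) := by
      have := IH (i - 3) (i + 3) (by omega); rwa [n3, show (i + 3 - 1 : ℤ) = i + 2 by ring] at this
    have t13 : S (i - 1) (i + 1) ≤ S i i := by
      have := IH (i - 1) (i + 1) (by omega); rwa [nz, show (i + 1 - 1 : ℤ) = i by ring] at this
    have t22 : S (i - 2) (i + 2) ≤ S (i - 1) (i + 1) := by
      have := IH (i - 2) (i + 2) (by omega); rwa [n2, show (i + 2 - 1 : ℤ) = i + 1 by ring] at this
    have t32 : S (i - 3) (i + 2) ≤ S (i - 2) (i + 1) := by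
      have := IH (i - 3) (i + 2) (by omega); rwa [n3, show (i + 2 - 1 : ℤ) = i + 1 by ring] at this
    have t23 : S (i - 2) (i + 1) ≤ S (i - 1) i := by
      have := IH (i - 2) (i + 1) (by omega); rwa [n2, show (i + 1 - 1 : ℤ) = i by ring] at this
    have t33 : S (i - 3) (i + 1) ≤ S (i - 2) i := by
      have := IH (i - 3) (i + 1) (by omega); rwa [n3, show (i + 1 - 1 : ℤ) = i by ring] at this
    have J1 := I1 i
    have t03 : S i (i + 1) ≤ S (i + 1) i := by linarith
    have P00 := mul_le_mul_of_nonneg_left t00 h00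
    have P10 := mul_le_mul_of_nonneg_left t10 h01
    have P01 := mul_le_mul_of_nonneg_left t01 h01
    have P20 := mul_le_mul_of_nonneg_left t20 h02
    have P02 := mul_le_mul_of_nonneg_left t02 h02
    have P30 := mul_le_mul_of_nonneg_left t30 h03
    have P03 := mul_le_mul_of_nonneg_left t03 h03
    have P11 := mul_le_mul_of_nonneg_left t11 h11
    have P21 := mul_le_mul_of_nonneg_left t21 h12
    have P12 := mul_le_mul_of_nonneg_left t12 h12
    have P31 := mul_le_mul_of_nonneg_left t31 h13
    have P13 := mul_le_mul_of_nonneg_left t13 h13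
    have P22 := mul_le_mul_of_nonneg_left t22 h22
    have P32 := mul_le_mul_of_nonneg_left t32 h23
    have P23 := mul_le_mul_of_nonneg_left t23 h23
    have P33 := mul_le_mul_of_nonneg_left t33 h33
    linarith
  · -- j ≥ i + 5: every term is a direct instance of STEP for `S`
    have t00 : S i j ≤ S (i + 1) (j - 1) := IH i j hij
    have t10 : S (i - 1) j ≤ S i (j - 1) := by have := IH (i - 1) j (by omega); rwa [nz] at this
    have t01 : S i (j - 1) ≤ S (i + 1) (j - 2) := by
      have := IH i (j - 1) (by omega); rwa [m1] at this
    have t20 : S (i - 2) j ≤ S (i - 1) (j - 1) := by have := IH (i - 2) j (by omega); rwa [n2] at this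
    have t02 : S i (j - 2) ≤ S (i + 1) (j - 3) := by
      have := IH i (j - 2) (by omega); rwa [m2] at this
    have t30 : S (i - 3) j ≤ S (i - 2) (j - 1) := by have := IH (i - 3) j (by omega); rwa [n3] at this
    have t03 : S i (j - 3) ≤ S (i + 1) (j - 4) := by
      have := IH i (j - 3) (by omega); rwa [m3] at this
    have t11 : S (i - 1) (j - 1) ≤ S i (j - 2) := by
      have := IH (i - 1) (j - 1) (by omega); rwa [nz, m1] at this
    have t21 : S (i - 2) (j - 1) ≤ S (i - 1) (j - 2) := by
      have := IH (i - 2) (j - 1) (by omega); rwa [n2, m1] at this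
    have t12 : S (i - 1) (j - 2) ≤ S i (j - 3) := by
      have := IH (i - 1) (j - 2) (by omega); rwa [nz, m2] at this
    have t31 : S (i - 3) (j - 1) ≤ S (i - 2) (j - 2) := by
      have := IH (i - 3) (j - 1) (by omega); rwa [n3, m1] at this
    have t13 : S (i - 1) (j - 3) ≤ S i (j - 4) := by
      have := IH (i - 1) (j - 3) (by omega); rwa [nz, m3] at this
    have t22 : S (i - 2) (j - 2) ≤ S (i - 1) (j - 3) := by
      have := IH (i - 2) (j - 2) (by omega); rwa [n2, m2] at this
    have t32 : S (i - 3) (j - 2) ≤ S (i - 2) (j - 3) := by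
      have := IH (i - 3) (j - 2) (by omega); rwa [n3, m2] at this
    have t23 : S (i - 2) (j - 3) ≤ S (i - 1) (j - 4) := by
      have := IH (i - 2) (j - 3) (by omega); rwa [n2, m3] at this
    have t33 : S (i - 3) (j - 3) ≤ S (i - 2) (j - 4) := by
      have := IH (i - 3) (j - 3) (by omega); rwa [n3, m3] at this
    have P00 := mul_le_mul_of_nonneg_left t00 h00
    have P10 := mul_le_mul_of_nonneg_left t10 h01
    have P01 := mul_le_mul_of_nonneg_left t01 h01
    have P20 := mul_le_mul_of_nonneg_left t20 h02
    have P02 := mul_le_mul_of_nonneg_left t02 h02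
    have P30 := mul_le_mul_of_nonneg_left t30 h03
    have P03 := mul_le_mul_of_nonneg_left t03 h03
    have P11 := mul_le_mul_of_nonneg_left t11 h11
    have P21 := mul_le_mul_of_nonneg_left t21 h12
    have P12 := mul_le_mul_of_nonneg_left t12 h12
    have P31 := mul_le_mul_of_nonneg_left t31 h13
    have P13 := mul_le_mul_of_nonneg_left t13 h13
    have P22 := mul_le_mul_of_nonneg_left t22 h22
    have P32 := mul_le_mul_of_nonneg_left t32 h23
    have P23 := mul_le_mul_of_nonneg_left t23 h23
    have P33 := mul_le_mul_of_nonneg_left t33 h33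
    linarith

/-- **STEP is closed under parallel composition with strands of edge-connectivity ≤ 3 that
satisfy STEP themselves** (`w02 + w03 ≤ w11 + w12 + w13`, `w03 ≤ w12 + w13`, `w13 ≤ w22 + w23`). -/
theorem stepH_step (h00 : ∀ k, 0 ≤ w00 k) (h01 : ∀ k, 0 ≤ w01 k) (h02 : ∀ k, 0 ≤ w02 k)
    (h03 : ∀ k, 0 ≤ w03 k) (h11 : ∀ k, 0 ≤ w11 k) (h12 : ∀ k, 0 ≤ w12 k) (h13 : ∀ k, 0 ≤ w13 k)
    (h22 : ∀ k, 0 ≤ w22 k) (h23 : ∀ k, 0 ≤ w23 k) (h33 : ∀ k, 0 ≤ w33 k)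
    (hB1 : ∀ k, w02 k + w03 k ≤ w11 k + w12 k + w13 k) (hB2 : ∀ k, w03 k ≤ w12 k + w13 k)
    (hB3 : ∀ k, w13 k ≤ w22 k + w23 k) :
    ∀ (m : ℕ) (i j : ℤ), i + 2 ≤ j →
      stepH w00 w01 w02 w03 w11 w12 w13 w22 w23 w33 m i j
        ≤ stepH w00 w01 w02 w03 w11 w12 w13 w22 w23 w33 m (i + 1) (j - 1)
  | 0, i, j, hij => by
      simp only [stepH]
      split_ifs <;> first | (norm_num; done) | (exfalso; omega)
  | m + 1, i, j, hij => by
      simp only [stepH]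
      have key := step_aux (stepH w00 w01 w02 w03 w11 w12 w13 w22 w23 w33 m) (w00 m) (w01 m)
        (w02 m) (w03 m) (w11 m) (w12 m) (w13 m) (w22 m) (w23 m) (w33 m) (h00 m) (h01 m) (h02 m)
        (h03 m) (h11 m) (h12 m) (h13 m) (h22 m) (h23 m) (h33 m) (hB1 m) (hB2 m) (hB3 m)
        (fun a b h => stepH_step h00 h01 h02 h03 h11 h12 h13 h22 h23 h33 hB1 hB2 hB3 m a b h)
        (stepH_swap w00 w01 w02 w03 w11 w12 w13 w22 w23 w33 m) i j hij
      simp only [show (i + 1 - 1 : ℤ) = i by ring, show (i + 1 - 2 : ℤ) = i - 1 by ring,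
        show (i + 1 - 3 : ℤ) = i - 2 by ring, show (j - 1 - 1 : ℤ) = j - 2 by ring,
        show (j - 1 - 2 : ℤ) = j - 3 by ring, show (j - 1 - 3 : ℤ) = j - 4 by ring]
      linarith
end Summit.Ventures.PercRepro2.Step3
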